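import Summits.KontsevichZagierPeriods.Zeta5Search.Barrier.ConeGammaCritBoxSound
import Literature.Analysis.ValidatedNumerics.MirandaTheorem

/-!
# ζ(5) search — BARRIER: CRITICAL VALUES ON BOXES — soundness II: Poincaré–Miranda gives a zero of BZ's system in
# every certified box

HONEST FRAMING (cell `pub-zeta5`): systematic search; no irrationality claim unless kernel-certified. Theorems (and the
real-side point map `boxPt`) about the computable checker of `ConeGammaCritBox`: **`exists_zero_of_faceCheck`** — if
the four exact face signs check (`faceCheck = true`, widths positive, `det M ≠ 0`), then for EVERY direction `t` of the
(open-box) box there are noises `η₁, η₂ ∈ [−1,1]` at which both polynomials of the chart (near: `F₁, F₂` at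
`(X + t₆, Y + t₆)`; far: `G₁, G₂` at `(X, Z)`) vanish at the box point — Poincaré–Miranda
(`Literature.Analysis.ValidatedNumerics.Miranda.exists_zero_of_miranda`, proved in the tree via Brouwer) applied to the
preconditioned map `M·(P₁, P₂)` on the box `[X̃ ± wx/Q] × [Ṽ ± wv/Q]` whose centre moves affinely with `t`. MODEL
objects (BZ's §5 system) under BZ (28)+(30); nothing about any γ of record, C2 (OPEN), S-E or `ζ(5)`. Theory seat
cert-2 g37.
-/

noncomputable section

open Set

namespace Summit.KontsevichZagierPeriods.Zeta5Search.Barrier.ConeGamma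

namespace CritBox

open Literature.Analysis.ValidatedNumerics (AForm)
open Literature.Analysis.ValidatedNumerics.AForm (Valid)

/-! ### Poincaré–Miranda on the moving box -/

/-- The box point of noises `(η₁, η₂)`: `X = (cx + Σ ax_j ε_{j+1} + wx η₁)/Q`, `V = (cv + … + wv η₂)/Q`. -/
def boxPt (D T : ℕ) (lo hi : List ℕ) (rd : RootData) (t : Fin 8 → ℝ) (η₁ η₂ : ℝ) : ℝ × ℝ :=
  (coordR rd.cx rd.ax rd.wx η₁ ((2 * D * T : ℕ) : ℝ) (noise D lo hi t η₁ η₂),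
   coordR rd.cv rd.av rd.wv η₂ ((2 * D * T : ℕ) : ℝ) (noise D lo hi t η₁ η₂))

/-- `linR` only sees `ε₁, …, ε₇`: it does not depend on `η₁, η₂`. -/
theorem linR_noise (a : List ℤ) (D : ℕ) (lo hi : List ℕ) (t : Fin 8 → ℝ) (η₁ η₂ η₁' η₂' : ℝ) :
    linR a (noise D lo hi t η₁ η₂) = linR a (noise D lo hi t η₁' η₂') := by
  simp [linR, noise]

/-- The polynomial systems are continuous in the point. -/
theorem continuous_sysR (far : Bool) (t : Fin 8 → ℝ) (m₁ m₂ : ℤ) :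
    Continuous fun p : Fin 2 → ℝ => (m₁ : ℝ) * (sysR far t (p 0) (p 1)).1 + m₂ * (sysR far t (p 0) (p 1)).2 := by
  unfold sysR
  cases far
  · simp only [Bool.false_eq_true, if_false, F1R, F2R]; fun_prop
  · simp only [if_true, G1R, G2R]; fun_prop

/-- **Poincaré–Miranda step.** If the four exact face signs check (and `wx, wv > 0`, `det M ≠ 0`), then for every
direction `t` of the (open-box) box there are noises `η₁, η₂ ∈ [−1,1]` at which both polynomials of the chart vanish
at the box point. -/
theorem exists_zero_of_faceCheck {D T : ℕ} {lo hi : List ℕ} {t : Fin 8 → ℝ} (hok : boxOKc D lo hi = true)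
    (hT : 0 < T) (h : t ∈ LemmaFBox.box D lo hi) (ht0 : t 0 = 1) {rd : RootData}
    (hface : faceCheck D T lo hi rd = true) (hwx : 0 < rd.wx) (hwv : 0 < rd.wv)
    (hdet : rd.m11 * rd.m22 - rd.m12 * rd.m21 ≠ 0) :
    ∃ η₁ η₂ : ℝ, |η₁| ≤ 1 ∧ |η₂| ≤ 1 ∧
      sysR rd.far t (boxPt D T lo hi rd t η₁ η₂).1 (boxPt D T lo hi rd t η₁ η₂).2 = (0, 0) := by
  have hD : 0 < D := by
    simp only [boxOKc, decide_eq_true_eq] at hok; exact hok.1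
  set Qn : ℕ := 2 * D * T with hQn
  have hQpos : (0 : ℝ) < (Qn : ℝ) := by rw [hQn]; positivity
  have hQ0 : ((Qn : ℕ) : ℝ) ≠ 0 := hQpos.ne'
  -- base noise (η = 0) and the moving centre
  set ε0 := noise D lo hi t 0 0 with hε0
  set Xc : ℝ := (rd.cx + linR rd.ax ε0) / Qn with hXc
  set Vc : ℝ := (rd.cv + linR rd.av ε0) / Qn with hVc
  set rx : ℝ := (rd.wx : ℝ) / Qn with hrx
  set rv : ℝ := (rd.wv : ℝ) / Qn with hrv
  have hrx0 : 0 < rx := by rw [hrx]; positivity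
  have hrv0 : 0 < rv := by rw [hrv]; positivity
  -- the preconditioned map
  let Fm : (Fin 2 → ℝ) → Fin 2 → ℝ := fun p =>
    ![(rd.m11 : ℝ) * (sysR rd.far t (p 0) (p 1)).1 + rd.m12 * (sysR rd.far t (p 0) (p 1)).2,
      (rd.m21 : ℝ) * (sysR rd.far t (p 0) (p 1)).1 + rd.m22 * (sysR rd.far t (p 0) (p 1)).2]
  let l : Fin 2 → ℝ := ![Xc - rx, Vc - rv]
  let u : Fin 2 → ℝ := ![Xc + rx, Vc + rv]
  have hlu : l ≤ u := fun i => by fin_cases i <;> simp [l, u] <;> linarith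
  have hcont : ContinuousOn Fm (Icc l u) := by
    apply Continuous.continuousOn
    refine continuous_pi fun i => ?_
    fin_cases i
    · exact continuous_sysR rd.far t rd.m11 rd.m12
    · exact continuous_sysR rd.far t rd.m21 rd.m22
  -- unpack the face checks
  simp only [faceCheck, Bool.and_eq_true, decide_eq_true_eq] at hface
  obtain ⟨⟨⟨hf1, hf2⟩, hf3⟩, hf4⟩ := hface
  -- a point of the box in noise coordinates
  have key : ∀ p ∈ Icc l u, ∃ η₁ η₂ : ℝ, |η₁| ≤ 1 ∧ |η₂| ≤ 1 ∧
      p 0 = coordR rd.cx rd.ax rd.wx η₁ Qn (noise D lo hi t η₁ η₂) ∧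
      p 1 = coordR rd.cv rd.av rd.wv η₂ Qn (noise D lo hi t η₁ η₂) := by
    intro p hp
    refine ⟨(p 0 - Xc) / rx, (p 1 - Vc) / rv, ?_, ?_, ?_, ?_⟩
    · rw [abs_div, abs_of_pos hrx0, div_le_one hrx0, abs_le]
      have h1 := hp.1 0; have h2 := hp.2 0; simp [l, u] at h1 h2; constructor <;> linarith
    · rw [abs_div, abs_of_pos hrv0, div_le_one hrv0, abs_le]
      have h1 := hp.1 1; have h2 := hp.2 1; simp [l, u] at h1 h2; constructor <;> linarith
    · rw [coordR, linR_noise rd.ax D lo hi t _ _ 0 0, ← hε0, hXc, hrx]; field_simp; ring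
    · rw [coordR, linR_noise rd.av D lo hi t _ _ 0 0, ← hε0, hVc, hrv]; field_simp; ring
  -- evaluation of the face polynomials at such a point
  have evalX : ∀ η₁ η₂ : ℝ, ∀ mode : ℕ, EPoly.eval (noise D lo hi t η₁ η₂) (coordPoly rd.cx rd.ax rd.wx mode)
      = (Qn : ℝ) * coordR rd.cx rd.ax rd.wx
          (if mode = 0 then -1 else if mode = 1 then 1 else if mode = 2 then η₁ else η₂) Qn (noise D lo hi t η₁ η₂) := by
    intro η₁ η₂ mode; rw [coordPoly_eval _ _ _ _ hQ0]; rfl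
  have evalV : ∀ η₁ η₂ : ℝ, ∀ mode : ℕ, EPoly.eval (noise D lo hi t η₁ η₂) (coordPoly rd.cv rd.av rd.wv mode)
      = (Qn : ℝ) * coordR rd.cv rd.av rd.wv
          (if mode = 0 then -1 else if mode = 1 then 1 else if mode = 2 then η₁ else η₂) Qn (noise D lo hi t η₁ η₂) := by
    intro η₁ η₂ mode; rw [coordPoly_eval _ _ _ _ hQ0]; rfl
  have hpow : ∀ k : ℕ, (0 : ℝ) < ((Qn : ℕ) : ℝ) ^ k := fun k => pow_pos hQpos k
  -- face conditions
  have hlo : ∀ p ∈ Icc l u, ∀ i, p i = l i → Fm p i ≤ 0 := by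
    intro p hp i hpi
    obtain ⟨η₁, η₂, hη₁, hη₂, hp0, hp1⟩ := key p hp
    fin_cases i
    · -- lower X-face: `p 0 = Xc − rx`; second coordinate free (`η₂`), encoded with `ε₈ := η₂`
      have hv := valid_noise hok h hη₂ hη₂
      have hpX : p 0 = coordR rd.cx rd.ax rd.wx (-1) Qn (noise D lo hi t η₂ η₂) := by
        simp [l] at hpi; rw [hpi, coordR, linR_noise rd.ax D lo hi t _ _ 0 0, ← hε0, hXc, hrx]; field_simp; ring
      have hpV : p 1 = coordR rd.cv rd.av rd.wv η₂ Qn (noise D lo hi t η₂ η₂) := by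
        rw [hp1, coordR, coordR, linR_noise rd.av D lo hi t η₁ η₂ η₂ η₂]
      have hs := sysPoly_eval (T := T) hok ht0 η₂ η₂ rd (XP := coordPoly rd.cx rd.ax rd.wx 0)
        (VP := coordPoly rd.cv rd.av rd.wv 2) (X := p 0) (V := p 1)
        (by rw [evalX, hpX]; norm_num [hQn]) (by rw [evalV, hpV]; norm_num [hQn]) false
      have hb := (EPoly.lower_le_eval hv (sysPoly D T lo hi rd (coordPoly rd.cx rd.ax rd.wx 0)
        (coordPoly rd.cv rd.av rd.wv 2) false)).2
      rw [hs] at hb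
      have hneg : (EPoly.upper (sysPoly D T lo hi rd (coordPoly rd.cx rd.ax rd.wx 0) (coordPoly rd.cv rd.av rd.wv 2) false) : ℝ) < 0 := by
        exact_mod_cast hf1
      simp only [if_false, Bool.false_eq_true] at hb
      have := hpow (if rd.far then 6 else 4)
      simp [Fm]
      by_contra hcon
      push Not at hcon
      have : (0 : ℝ) < ((Qn : ℕ) : ℝ) ^ (if rd.far then 6 else 4) *
          ((rd.m11 : ℝ) * (sysR rd.far t (p 0) (p 1)).1 + rd.m12 * (sysR rd.far t (p 0) (p 1)).2) :=
        mul_pos this hcon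
      linarith
    · -- lower V-face
      have hv := valid_noise hok h hη₁ hη₁
      have hpV : p 1 = coordR rd.cv rd.av rd.wv (-1) Qn (noise D lo hi t η₁ η₁) := by
        simp [l] at hpi; rw [hpi, coordR, linR_noise rd.av D lo hi t _ _ 0 0, ← hε0, hVc, hrv]; field_simp; ring
      have hpX : p 0 = coordR rd.cx rd.ax rd.wx η₁ Qn (noise D lo hi t η₁ η₁) := by
        rw [hp0, coordR, coordR, linR_noise rd.ax D lo hi t η₁ η₂ η₁ η₁]
      have hs := sysPoly_eval (T := T) hok ht0 η₁ η₁ rd (XP := coordPoly rd.cx rd.ax rd.wx 2)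
        (VP := coordPoly rd.cv rd.av rd.wv 0) (X := p 0) (V := p 1)
        (by rw [evalX, hpX]; norm_num [hQn]) (by rw [evalV, hpV]; norm_num [hQn]) true
      have hb := (EPoly.lower_le_eval hv (sysPoly D T lo hi rd (coordPoly rd.cx rd.ax rd.wx 2)
        (coordPoly rd.cv rd.av rd.wv 0) true)).2
      rw [hs] at hb
      have hneg : (EPoly.upper (sysPoly D T lo hi rd (coordPoly rd.cx rd.ax rd.wx 2) (coordPoly rd.cv rd.av rd.wv 0) true) : ℝ) < 0 := by
        exact_mod_cast hf3
      simp only [if_true] at hb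
      have := hpow (if rd.far then 6 else 4)
      simp [Fm]
      by_contra hcon
      push Not at hcon
      have : (0 : ℝ) < ((Qn : ℕ) : ℝ) ^ (if rd.far then 6 else 4) *
          ((rd.m21 : ℝ) * (sysR rd.far t (p 0) (p 1)).1 + rd.m22 * (sysR rd.far t (p 0) (p 1)).2) :=
        mul_pos this hcon
      linarith
  have hup : ∀ p ∈ Icc l u, ∀ i, p i = u i → 0 ≤ Fm p i := by
    intro p hp i hpi
    obtain ⟨η₁, η₂, hη₁, hη₂, hp0, hp1⟩ := key p hp
    fin_cases i
    · have hv := valid_noise hok h hη₂ hη₂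
      have hpX : p 0 = coordR rd.cx rd.ax rd.wx 1 Qn (noise D lo hi t η₂ η₂) := by
        simp [u] at hpi; rw [hpi, coordR, linR_noise rd.ax D lo hi t _ _ 0 0, ← hε0, hXc, hrx]; field_simp
      have hpV : p 1 = coordR rd.cv rd.av rd.wv η₂ Qn (noise D lo hi t η₂ η₂) := by
        rw [hp1, coordR, coordR, linR_noise rd.av D lo hi t η₁ η₂ η₂ η₂]
      have hs := sysPoly_eval (T := T) hok ht0 η₂ η₂ rd (XP := coordPoly rd.cx rd.ax rd.wx 1)
        (VP := coordPoly rd.cv rd.av rd.wv 2) (X := p 0) (V := p 1)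
        (by rw [evalX, hpX]; norm_num [hQn]) (by rw [evalV, hpV]; norm_num [hQn]) false
      have hb := (EPoly.lower_le_eval hv (sysPoly D T lo hi rd (coordPoly rd.cx rd.ax rd.wx 1)
        (coordPoly rd.cv rd.av rd.wv 2) false)).1
      rw [hs] at hb
      have hpos : (0 : ℝ) < (EPoly.lower (sysPoly D T lo hi rd (coordPoly rd.cx rd.ax rd.wx 1) (coordPoly rd.cv rd.av rd.wv 2) false) : ℝ) := by
        exact_mod_cast hf2
      simp only [if_false, Bool.false_eq_true] at hb
      have hq := hpow (if rd.far then 6 else 4)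
      simp [Fm]
      by_contra hcon
      push Not at hcon
      have : ((Qn : ℕ) : ℝ) ^ (if rd.far then 6 else 4) *
          ((rd.m11 : ℝ) * (sysR rd.far t (p 0) (p 1)).1 + rd.m12 * (sysR rd.far t (p 0) (p 1)).2) < 0 :=
        mul_neg_of_pos_of_neg hq hcon
      linarith
    · have hv := valid_noise hok h hη₁ hη₁
      have hpV : p 1 = coordR rd.cv rd.av rd.wv 1 Qn (noise D lo hi t η₁ η₁) := by
        simp [u] at hpi; rw [hpi, coordR, linR_noise rd.av D lo hi t _ _ 0 0, ← hε0, hVc, hrv]; field_simp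
      have hpX : p 0 = coordR rd.cx rd.ax rd.wx η₁ Qn (noise D lo hi t η₁ η₁) := by
        rw [hp0, coordR, coordR, linR_noise rd.ax D lo hi t η₁ η₂ η₁ η₁]
      have hs := sysPoly_eval (T := T) hok ht0 η₁ η₁ rd (XP := coordPoly rd.cx rd.ax rd.wx 2)
        (VP := coordPoly rd.cv rd.av rd.wv 1) (X := p 0) (V := p 1)
        (by rw [evalX, hpX]; norm_num [hQn]) (by rw [evalV, hpV]; norm_num [hQn]) true
      have hb := (EPoly.lower_le_eval hv (sysPoly D T lo hi rd (coordPoly rd.cx rd.ax rd.wx 2)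
        (coordPoly rd.cv rd.av rd.wv 1) true)).1
      rw [hs] at hb
      have hpos : (0 : ℝ) < (EPoly.lower (sysPoly D T lo hi rd (coordPoly rd.cx rd.ax rd.wx 2) (coordPoly rd.cv rd.av rd.wv 1) true) : ℝ) := by
        exact_mod_cast hf4
      simp only [if_true] at hb
      have hq := hpow (if rd.far then 6 else 4)
      simp [Fm]
      by_contra hcon
      push Not at hcon
      have : ((Qn : ℕ) : ℝ) ^ (if rd.far then 6 else 4) *
          ((rd.m21 : ℝ) * (sysR rd.far t (p 0) (p 1)).1 + rd.m22 * (sysR rd.far t (p 0) (p 1)).2) < 0 :=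
        mul_neg_of_pos_of_neg hq hcon
      linarith
  obtain ⟨p, hp, hzero⟩ := Literature.Analysis.ValidatedNumerics.Miranda.exists_zero_of_miranda hlu hcont hlo hup
  obtain ⟨η₁, η₂, hη₁, hη₂, hp0, hp1⟩ := key p hp
  refine ⟨η₁, η₂, hη₁, hη₂, ?_⟩
  have h0 : Fm p 0 = 0 := by rw [hzero]; rfl
  have h1 : Fm p 1 = 0 := by rw [hzero]; rfl
  simp only [Fm, Matrix.cons_val_zero, Matrix.cons_val_one] at h0 h1
  have hd : ((rd.m11 * rd.m22 - rd.m12 * rd.m21 : ℤ) : ℝ) ≠ 0 := by exact_mod_cast hdet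
  push_cast at hd
  have e1 : (sysR rd.far t (p 0) (p 1)).1 = 0 := by
    have : ((rd.m11 : ℝ) * rd.m22 - rd.m12 * rd.m21) * (sysR rd.far t (p 0) (p 1)).1 = 0 := by
      linear_combination (rd.m22 : ℝ) * h0 - (rd.m12 : ℝ) * h1
    exact (mul_eq_zero.1 this).resolve_left hd
  have e2 : (sysR rd.far t (p 0) (p 1)).2 = 0 := by
    have : ((rd.m11 : ℝ) * rd.m22 - rd.m12 * rd.m21) * (sysR rd.far t (p 0) (p 1)).2 = 0 := by
      linear_combination (rd.m11 : ℝ) * h1 - (rd.m21 : ℝ) * h0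
    exact (mul_eq_zero.1 this).resolve_left hd
  have hpt : boxPt D T lo hi rd t η₁ η₂ = (p 0, p 1) := by
    simp only [boxPt]; rw [hp0, hp1]
  rw [hpt]
  exact Prod.ext e1 e2

end CritBox

end Summit.KontsevichZagierPeriods.Zeta5Search.Barrier.ConeGamma

end
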